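import Summits.HubbardSuperconductivity.HubbardSuperconductivity.Theses.IntrinsicLargeN
import Summits.HubbardSuperconductivity.HubbardSuperconductivity.Theorems.BalabanIRBirGroundStateAverageLROBounds
import Summits.HubbardSuperconductivity.HubbardSuperconductivity.Theorems.NoGoNogoThesis
import HarnessLib

/-!
# Crux `PairSectorShadow` (stmt-HubbardSuperconductivity-10970; route `IntrinsicLargeN`, rank 2) —
# BIRTH SKELETON `Lines/birth.lean` (BC3)

THE CRUX (fixed; `Theses/IntrinsicLargeN.lean`, decl `PairSectorShadow`, not restated here): under
certified Kohn–Luttinger `B1g` attraction + dominance at doping `δ ∈ (0,1/2)` there are `κ, U₀ > 0`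
such that for every `U ∈ (0, U₀)` there are `g ≥ κU²`, `ε, θ < 1`, `L₀` with: on every even torus
`L ≥ L₀` SOME normalised `(N_L, S^z = 0)`-sector ground state `ψ₀` of `hubbardTorus 2 L 1 U` has a unit
shadow `φ` in the same sector which is an `ε`-near ground state of the reduced d-wave BCS model
`H_red(g) = T − (g/L²)Δ_d†Δ_d` and carries at most `(1−θ)⁻¹` times the d-wave pair LRO of `ψ₀`.

WHAT THE CRUX IS, MODULO PROVED THINGS (refuter evidence `Collapse.lean` on the item, 2026-08-15, both
directions certified): since `g` is only bounded below and `ε, θ` are chosen after `U`, the crux is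
equivalent to SOME-GROUND-STATE UNIFORM d-WAVE LRO — for every small `U` some sector ground state has
`Re⟨ψ₀, Δ_d†Δ_d ψ₀⟩ ≥ a(U)·L⁴` on all large even tori. Any skeleton of the crux is therefore a
skeleton of that statement; this one cuts it at the classical joint SOURCED ORDER / RESPONSE, with the
ROUTE'S OWN PERTURBATION as the source: the reduced d-wave BCS attraction. Put
`f_L(λ) := minE over szSector N_L 0 of (hubbardTorus 2 L 1 U − (λ/L²)·Δ_d†Δ_d)`
(the pure Hubbard model plus a reduced d-wave BCS attraction of strength `λ`; `f_L` is concave in `λ`,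
and by Feynman–Hellmann `−L²·f_L'(0⁺) = max over sector ground states of Re⟨ψ, Δ_d†Δ_d ψ⟩`).

1. `stub_sourcedPairCondensation` — SPONTANEOUS `|Δ_d|²`-ORDER, thermodynamic limit first (the famous
   half; keeps the Kohn–Luttinger hypothesis, which makes d-wave the realised channel): under the crux's
   hypothesis, for all small `U` there are `a > 0`, `λ₁ > 0` such that for every FIXED `λ ∈ (0, λ₁]`,
   eventually in even `L`, `f_L(λ) + a·λ·L² ≤ f_L(0)`: switching on a weak reduced d-wave attraction
   lowers the sector ground energy to FIRST order in `λ`, uniformly in the volume — in the limit,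
   `−e'(0⁺) ≥ a` for `e(λ) = lim f_L(λ)/L²` (a `U(1)`-invariant, number-conserving source: no
   grand-canonical detour, no symmetry-breaking field). Strictly weaker than the crux (a condensed ground
   state `ψ₀` used as a trial state gives it for every `λ > 0`); the converse at fixed `L` would need
   `λ → 0⁺` before `L → ∞`, which is exactly what stub 2 supplies. Why plausibly true: it is the
   energy form of weak-coupling d-wave superconductivity (BCS/Kohn–Luttinger: `f_L(0) − f_L(λ) ≈
   λ·m(U)²·L²`, `m²` the condensate density of the reduced model at the effective coupling, cf. the
   landed anchor `Theorems.IntrinsicLargeN.reducedBCSAnchor_proof` for the `N = ∞` member). Why it might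
   fail: a competing order along `U_n → 0⁺`, or an energy gain that is `o(λ)` uniformly (no condensate).
   Size: crux-hard (needs the sector ground energy of the doped 2D Hubbard model to relative accuracy
   `λ·a(U)` per site — the `WeakCouplingCeiling` barrier applies to this stub, as it does to the crux).
2. `stub_linearPairResponse` — LINEAR RESPONSE / "SSB ⟹ LRO" (the Griffiths–Koma–Tasaki direction, no
   Kohn–Luttinger hypothesis needed): for all small `U` and every `η > 0` there is `λ₂ > 0` such that
   for every fixed `λ ∈ (0, λ₂]`, eventually in even `L`, SOME normalised sector ground state `ψ₀` of the
   PURE model has `f_L(0) ≤ f_L(λ) + (λ/L²)·Re⟨ψ₀, Δ_d†Δ_d ψ₀⟩ + η·λ·L²`: the energy gained from the weak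
   attraction is captured, up to `ηλL²`, by the first-order (Feynman–Hellmann) term of the best ground
   state — in the limit `−e'(0⁺) ≤ liminf_L max_GS Re⟨Δ_d†Δ_d⟩/L⁴`, i.e. spontaneous `|Δ_d|²`-order
   does not exceed finite-volume ground-state LRO. Trivially true for `η ≥ C_d²` (`f_L(0) − f_L(λ) ≤
   λ·C_d²·L²` by the variational principle and `‖Δ_d‖ ≤ C_d L²`); the content is small `η`
   (bounded amplitude susceptibility; `Δ_d†Δ_d` is `U(1)`-invariant, so there is no Koma–Tasaki
   `1/n` factor). Why it might fail: a quasi-condensate with divergent d-wave pair susceptibility and no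
   LRO along `U_n → 0⁺` (energy gain `≫` first order). Size: M–L (a two-sided perturbation estimate for
   the ground-state energy in a `U(1)`-invariant quadratic source; open for interacting fermions).

COMPOSITION `PairSectorShadow_of : Sig.stub_sourcedPairCondensation → Sig.stub_linearPairResponse →
PairSectorShadow` (the stub statements BY NAME; sorry-free,
~110 lines with the glue lemma `shadow_of_condensed`, NOT a one-line seam; axioms propext,
Classical.choice, Quot.sound): at `λ := min λ₁ λ₂(η := a/2)` the two stubs squeeze
`a·λ·L² ≤ f_L(0) − f_L(λ) ≤ (λ/L²)·Re⟨ψ₀, Δ_d†Δ_d ψ₀⟩ + (a/2)·λ·L²`, whence a sector ground state with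
`Re⟨ψ₀, Δ_d†Δ_d ψ₀⟩ ≥ (a/2)·L⁴`; then the shadow is built as in the refuter's certified collapse
(`shadow_of_condensed`, abstract form over any `T`, `P ≥ 0`, sector `K`): `κ := 1`, `g := U²`, `ε := 1/2`, `θ := 1 − (a/2)/(C_d² + 1)`,
`φ :=` an `sInf`-approximant of `H_red(g)` in the sector when `minE(H_red) < minE(T)`, else the free
sector ground state (`Δ_d†Δ_d ≥ 0`); clause (ii) from `Re⟨φ, Δ_d†Δ_dφ⟩ ≤ C_d² L⁴`
(`Theorems.re_expect_pairField_conjTranspose_mul_le`). `PairSectorShadow_of_stubs : PairSectorShadow`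
records the same composition applied to the two declared stubs (harness convention A12).

DISPROOF USED: no `Cruxes/PairSectorShadow/Disproof.lean` exists (2026-08-17, `ledger crux ls`); the
item's refuter evidence (`Collapse.lean`, `Repair.lean`, `EVIDENCE.md`, 2026-08-15) is honoured: the
skeleton does not pretend the KL-scale clause carries content (it routes through SomeGSLRO explicitly)
and neither stub is the crux or the summit reworded (stub 1 is implied by the crux but not conversely
at fixed `L`; stub 2 is not implied by the crux; neither mentions a shadow, `g`, `ε` or `θ`). No landed
Negative lemma exists for this crux; `ledger negatives --problem HubbardSuperconductivity` lists no refuted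
statement of the shape of either stub (sourced sector-energy gain / first-order pair response).

BC3 PROBES (registrar folder `bc/probe_stub{1,2}_{crux,summit}.lean`, each stub statement alone in
scope, importing only the route module; `first | exact? | simpa | aesop`, `maxHeartbeats 400000`, farm
`lean check`): `stub → PairSectorShadow` and `stub → HubbardSuperconductivity` FAIL for both stubs (4/4:
rc 1, `unsolved goals ⊢ …`, "aesop: failed to prove the goal after exhaustive search"); see
`Lines/birth.md` for the table. Skeleton audit: rc 0, `sorry` count 2 = stub count, zero elsewhere.

Sources: T. Koma, H. Tasaki, J. Stat. Phys. 76 (1994) 745, §0.7 and Thm 2.3 (LRO vs symmetry breaking,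
the direction of stub 2); R. B. Griffiths, Phys. Rev. 152 (1966) 240 (sourced order parameters);
T. A. Kaplan, P. Horsch, W. von der Linden, J. Phys. Soc. Jpn. 58 (1989) 3894 (concavity of the ground
energy in a pair coupling; cf. `Theorems.DeformationLadder.pairingMonotonicity_proof`); W. Kohn,
J. M. Luttinger, PRL 15 (1965) 524; S. Raghu, S. A. Kivelson, D. J. Scalapino, PRB 81 (2010) 224505
(arXiv:1002.0591) §II–III; H. Tasaki, *Physics and Mathematics of Quantum Many-Body Systems* (2020)
§2.2 (variational principle). No definition is introduced besides the two names `Sig.stub_*` for the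
stub statements (verbatim Props); all statements are over existing declarations.
-/

noncomputable section

-- `dupNamespace`: the summit and the problem are both named `HubbardSuperconductivity` (layout D-0022)
set_option linter.dupNamespace false

namespace Summit.HubbardSuperconductivity.HubbardSuperconductivity.Cruxes.PairSectorShadow.Birth

open Matrix Finset Filter
open Literature.Probability.LatticeModels Literature.MathematicalPhysics.QuantumLattice
open Summit.HubbardSuperconductivity.HubbardSuperconductivity.Theorems
  (re_expect_pairField_conjTranspose_mul_le)
open Summit.HubbardSuperconductivity.NoGo
  (exists_unit_groundStateInSector_hubbardTorus floor_pairNumber_le)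
open scoped ComplexOrder Matrix

/-! ## The two stub STATEMENTS (named, so that the composition cites them by name) -/

/-- **STUB 1 `stub_sourcedPairCondensation` — spontaneous `|Δ_d|²`-order in energy form,
thermodynamic limit first.** Under certified `B1g` attraction + dominance at `δ ∈ (0,1/2)` there is
`U₀ > 0` such that for every `U ∈ (0, U₀)` there are `a > 0` and `λ₁ > 0` with: for every
`λ ∈ (0, λ₁]` there is `L₀` such that for all even `L ≥ L₀`
`minE_S(H_U − (λ/L²)Δ_d†Δ_d) + a·λ·L² ≤ minE_S(H_U)`, `H_U = hubbardTorus 2 L 1 U`,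
`S = szSector (2⌊(1−δ)L²/2⌋) 0`: a weak reduced d-wave BCS attraction lowers the sector ground energy
to first order in its strength, uniformly in the volume. Implied by the crux (trial state); the
converse needs stub 2. Kohn–Luttinger (1965); Raghu–Kivelson–Scalapino (2010) §II–III;
Griffiths (1966). -/
def Sig.stub_sourcedPairCondensation : Prop :=
    ∀ δ ∈ Set.Ioo (0:ℝ) (1/2), ∀ γ U₁ : ℝ, 0 < γ → 0 < U₁ →
      (∀ U ∈ Set.Ioo (0:ℝ) U₁,
        channelInf (squareDispersion 1 0) (chemicalPotentialOfDensity (squareDispersion 1 0) (1 - δ)) U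
            D4Irrep.B1g ≤ -(γ * U ^ 2) ∧
          ∀ χ : D4Irrep, χ ≠ D4Irrep.B1g →
            channelInf (squareDispersion 1 0) (chemicalPotentialOfDensity (squareDispersion 1 0) (1 - δ)) U
                D4Irrep.B1g + γ * U ^ 2 ≤
              channelInf (squareDispersion 1 0) (chemicalPotentialOfDensity (squareDispersion 1 0) (1 - δ))
                U χ) →
      ∃ U₀ : ℝ, 0 < U₀ ∧ ∀ U ∈ Set.Ioo (0:ℝ) U₀, ∃ a : ℝ, 0 < a ∧ ∃ l₁ : ℝ, 0 < l₁ ∧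
        ∀ l ∈ Set.Ioc (0:ℝ) l₁, ∃ L₀ : ℕ, ∀ (L : ℕ) [NeZero L], L₀ ≤ L → Even L →
          (hubbardTorus 2 L 1 U - ((l / (L : ℝ) ^ 2 : ℝ) : ℂ) •
                ((pairField dWaveFormFactor L)ᴴ * pairField dWaveFormFactor L)).minEnergyOn
              (szSector (2 * ⌊(1 - δ) * (L : ℝ) ^ 2 / 2⌋₊) 0) +
            a * l * (L : ℝ) ^ 2 ≤
          (hubbardTorus 2 L 1 U).minEnergyOn (szSector (2 * ⌊(1 - δ) * (L : ℝ) ^ 2 / 2⌋₊) 0)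

/-- **STUB 2 `stub_linearPairResponse` — the energy gained from a weak reduced d-wave attraction is
first order in the best ground state's own pair LRO ("SSB ⟹ LRO" direction).** For every
`δ ∈ (0,1/2)` there is `U₀ > 0` such that for every `U ∈ (0, U₀)` and every `η > 0` there is `λ₂ > 0`
with: for every `λ ∈ (0, λ₂]` there is `L₀` such that for all even `L ≥ L₀` SOME normalised
`(2⌊(1−δ)L²/2⌋, S^z = 0)`-sector ground state `ψ₀` of `hubbardTorus 2 L 1 U` satisfies
`minE_S(H_U) ≤ minE_S(H_U − (λ/L²)Δ_d†Δ_d) + (λ/L²)·Re⟨ψ₀, Δ_d†Δ_d ψ₀⟩ + η·λ·L²`. Trivial for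
`η ≥ C_d²`; the content is small `η`. Koma–Tasaki (1994) §0.7, Thm 2.3; Kaplan–Horsch–von der Linden
(1989); Tasaki (2020) §2.2. -/
def Sig.stub_linearPairResponse : Prop :=
    ∀ δ ∈ Set.Ioo (0:ℝ) (1/2), ∃ U₀ : ℝ, 0 < U₀ ∧ ∀ U ∈ Set.Ioo (0:ℝ) U₀, ∀ η : ℝ, 0 < η →
      ∃ l₂ : ℝ, 0 < l₂ ∧ ∀ l ∈ Set.Ioc (0:ℝ) l₂, ∃ L₀ : ℕ, ∀ (L : ℕ) [NeZero L], L₀ ≤ L → Even L →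
        ∃ ψ₀ : Fock (Orb (FermionTorus 2 L)), star ψ₀ ⬝ᵥ ψ₀ = 1 ∧
          IsGroundStateInSector (hubbardTorus 2 L 1 U) (2 * ⌊(1 - δ) * (L : ℝ) ^ 2 / 2⌋₊) 0 ψ₀ ∧
          (hubbardTorus 2 L 1 U).minEnergyOn (szSector (2 * ⌊(1 - δ) * (L : ℝ) ^ 2 / 2⌋₊) 0) ≤
            (hubbardTorus 2 L 1 U - ((l / (L : ℝ) ^ 2 : ℝ) : ℂ) •
                  ((pairField dWaveFormFactor L)ᴴ * pairField dWaveFormFactor L)).minEnergyOn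
                (szSector (2 * ⌊(1 - δ) * (L : ℝ) ^ 2 / 2⌋₊) 0) +
              l / (L : ℝ) ^ 2 *
                (expect ((pairField dWaveFormFactor L)ᴴ * pairField dWaveFormFactor L) ψ₀).re +
              η * l * (L : ℝ) ^ 2

/-! ## Registered stubs (the ONLY `sorry`s of this file) -/

/-- Registered stub 1 — spontaneous `|Δ_d|²`-order in energy form (the bet; crux-hard). -/
theorem stub_sourcedPairCondensation : Sig.stub_sourcedPairCondensation := by
  sorry

/-- Registered stub 2 — linear pair response / "SSB ⟹ LRO" direction (size M–L). -/
theorem stub_linearPairResponse : Sig.stub_linearPairResponse := by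
  sorry

/-! ## Sorry-free glue: from a condensed sector ground state to the shadow -/

/-- `Δ_d†Δ_d` has nonnegative expectation (a Gram operator). [folklore] -/
theorem re_rayleigh_pairSq_nonneg (L : ℕ) [NeZero L] (φ : Fock (Orb (FermionTorus 2 L))) :
    0 ≤ (star φ ⬝ᵥ ((pairField dWaveFormFactor L)ᴴ * pairField dWaveFormFactor L) *ᵥ φ).re := by
  have h : star φ ⬝ᵥ ((pairField dWaveFormFactor L)ᴴ * pairField dWaveFormFactor L) *ᵥ φ =
      star (pairField dWaveFormFactor L *ᵥ φ) ⬝ᵥ (pairField dWaveFormFactor L *ᵥ φ) :=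
    PosSemidefTrace.expect_conjTranspose_mul _ _ φ
  rw [h, ← norm_toLp_sq_eq_re]
  positivity

/-- The quartic a-priori bound with an `L`-independent constant: for a unit vector `φ`,
`Re⟨φ, Δ_d†Δ_d φ⟩ ≤ (C_d² + 1)·L⁴`. [folklore] -/
theorem re_rayleigh_pairSq_le (L : ℕ) [NeZero L] (φ : Fock (Orb (FermionTorus 2 L)))
    (hφ : star φ ⬝ᵥ φ = 1) :
    (star φ ⬝ᵥ ((pairField dWaveFormFactor L)ᴴ * pairField dWaveFormFactor L) *ᵥ φ).re ≤
      ((∑ e ∈ insert 0 unitSteps, ‖((dWaveFormFactor e / Real.sqrt 2 : ℝ) : ℂ)‖ * 2) ^ 2 + 1) *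
        (L : ℝ) ^ 4 := by
  have h := re_expect_pairField_conjTranspose_mul_le dWaveFormFactor L φ
  rw [hφ, Complex.one_re, mul_one] at h
  have hL4 : (0 : ℝ) ≤ (L : ℝ) ^ 4 := by positivity
  calc (star φ ⬝ᵥ ((pairField dWaveFormFactor L)ᴴ * pairField dWaveFormFactor L) *ᵥ φ).re
      ≤ ((∑ e ∈ insert 0 unitSteps, ‖((dWaveFormFactor e / Real.sqrt 2 : ℝ) : ℂ)‖ * 2) *
          (L : ℝ) ^ 2) ^ 2 := h
    _ = (∑ e ∈ insert 0 unitSteps, ‖((dWaveFormFactor e / Real.sqrt 2 : ℝ) : ℂ)‖ * 2) ^ 2 *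
          (L : ℝ) ^ 4 := by ring
    _ ≤ ((∑ e ∈ insert 0 unitSteps, ‖((dWaveFormFactor e / Real.sqrt 2 : ℝ) : ℂ)‖ * 2) ^ 2 + 1) *
          (L : ℝ) ^ 4 := by
        apply mul_le_mul_of_nonneg_right _ hL4
        linarith

/-- **The collapse step, abstract form** (the refuter's certified observation on the item, re-proved):
for matrices `T`, `P` with `P ≥ 0` in expectation and `Re⟨φ, P φ⟩ ≤ B·s` on unit vectors, a subspace
`K` carrying a unit `T`-eigenvector at the sector energy `minEnergyOn T K`, a coupling `κ ≥ 0` and a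
unit `ψ₀ ∈ K` with `a·s ≤ Re⟨ψ₀, P ψ₀⟩`, there is a unit `φ ∈ K` which is a `½`-near ground state of
`T − κP` in `K` and has `(1 − (1 − a/B))·Re⟨φ, P φ⟩ ≤ Re⟨ψ₀, P ψ₀⟩`: `φ` is an `sInf`-approximant
of `T − κP` in `K` when `minE(T − κP) < minE(T)`, and the `T`-eigenvector otherwise.
Tasaki (2020) §2.2 (variational principle). [folklore] -/
theorem shadow_of_condensed {n : Type*} [Fintype n] [DecidableEq n]
    (T P : Matrix n n ℂ) (K : Submodule ℂ (n → ℂ)) (κ a B s : ℝ) (hκ : 0 ≤ κ) (ha : 0 < a)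
    (hB : 0 < B) (hs : 0 < s)
    (hP : ∀ φ : n → ℂ, 0 ≤ (star φ ⬝ᵥ P *ᵥ φ).re)
    (hPB : ∀ φ : n → ℂ, star φ ⬝ᵥ φ = 1 → (star φ ⬝ᵥ P *ᵥ φ).re ≤ B * s)
    (hT : ∃ φ₀ ∈ K, star φ₀ ⬝ᵥ φ₀ = 1 ∧ T *ᵥ φ₀ = ((T.minEnergyOn K : ℝ) : ℂ) • φ₀)
    (ψ₀ : n → ℂ) (hψ₀K : ψ₀ ∈ K) (hψ₀ : star ψ₀ ⬝ᵥ ψ₀ = 1)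
    (hX : a * s ≤ (star ψ₀ ⬝ᵥ P *ᵥ ψ₀).re) :
    ∃ φ ∈ K, star φ ⬝ᵥ φ = 1 ∧
      (star φ ⬝ᵥ (T - (κ : ℂ) • P) *ᵥ φ).re ≤ (T - (κ : ℂ) • P).minEnergyOn K +
        1 / 2 * (T.minEnergyOn K - (T - (κ : ℂ) • P).minEnergyOn K) ∧
      (1 - (1 - a / B)) * (star φ ⬝ᵥ P *ᵥ φ).re ≤ (star ψ₀ ⬝ᵥ P *ᵥ ψ₀).re := by
  -- clause (ii) holds for every unit vector
  have hii : ∀ φ : n → ℂ, star φ ⬝ᵥ φ = 1 →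
      (1 - (1 - a / B)) * (star φ ⬝ᵥ P *ᵥ φ).re ≤ (star ψ₀ ⬝ᵥ P *ᵥ ψ₀).re := by
    intro φ hφ
    have e1 : (1 - (1 - a / B)) = a / B := by ring
    rw [e1]
    calc a / B * (star φ ⬝ᵥ P *ᵥ φ).re ≤ a / B * (B * s) :=
          mul_le_mul_of_nonneg_left (hPB φ hφ) (by positivity)
      _ = a * s := by field_simp
      _ ≤ (star ψ₀ ⬝ᵥ P *ᵥ ψ₀).re := hX
  by_cases hmM : (T - (κ : ℂ) • P).minEnergyOn K < T.minEnergyOn K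
  · -- an `sInf`-approximant of `T - κP` in `K` (no `BddBelow` needed)
    have hne : ({E : ℝ | ∃ ψ ∈ K, star ψ ⬝ᵥ ψ = 1 ∧
        E = (star ψ ⬝ᵥ (T - (κ : ℂ) • P) *ᵥ ψ).re}).Nonempty :=
      ⟨_, ψ₀, hψ₀K, hψ₀, rfl⟩
    have hlt : (T - (κ : ℂ) • P).minEnergyOn K < (T - (κ : ℂ) • P).minEnergyOn K +
        1 / 2 * (T.minEnergyOn K - (T - (κ : ℂ) • P).minEnergyOn K) := by
      linarith
    obtain ⟨E, ⟨φ, hφK, hφ1, rfl⟩, hElt⟩ := exists_lt_of_csInf_lt hne hlt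
    exact ⟨φ, hφK, hφ1, le_of_lt hElt, hii φ hφ1⟩
  · -- the `T`-ground state of the sector
    push Not at hmM
    obtain ⟨φ, hφK, hφ1, hφeig⟩ := hT
    refine ⟨φ, hφK, hφ1, ?_, hii φ hφ1⟩
    have hTM : (star φ ⬝ᵥ T *ᵥ φ).re = T.minEnergyOn K := by
      rw [hφeig, dotProduct_smul, hφ1, smul_eq_mul, mul_one, Complex.ofReal_re]
    have hsplit : (star φ ⬝ᵥ (T - (κ : ℂ) • P) *ᵥ φ).re =
        (star φ ⬝ᵥ T *ᵥ φ).re - κ * (star φ ⬝ᵥ P *ᵥ φ).re := by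
      rw [sub_mulVec, dotProduct_sub, Complex.sub_re, smul_mulVec, dotProduct_smul, smul_eq_mul,
        Complex.re_ofReal_mul]
    have hprod : 0 ≤ κ * (star φ ⬝ᵥ P *ᵥ φ).re := mul_nonneg hκ (hP φ)
    rw [hsplit, hTM]
    linarith

/-! ## The composition: the two stub statements imply the crux, by name -/

/-- **`PairSectorShadow_of`** — `Sig.stub_sourcedPairCondensation → Sig.stub_linearPairResponse →
IntrinsicLargeN.PairSectorShadow` (the two stub statements, by name), sorry-free. At `λ := min λ₁ λ₂(η := a/2)` and `L ≥ max L₀¹ L₀²` the stubs squeeze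
`a·λ·L² ≤ f_L(0) − f_L(λ) ≤ (λ/L²)·Re⟨ψ₀, Δ_d†Δ_d ψ₀⟩ + (a/2)·λ·L²`, so the sector ground state `ψ₀`
of stub 2 has `Re⟨ψ₀, Δ_d†Δ_d ψ₀⟩ ≥ (a/2)·L⁴`; the shadow is then `shadow_of_condensed` with
`κ := 1`, `g := U²`, `ε := 1/2`, `θ := 1 − (a/2)/(C_d² + 1)`. [folklore] -/
theorem PairSectorShadow_of :
    Sig.stub_sourcedPairCondensation → Sig.stub_linearPairResponse →
      Summit.HubbardSuperconductivity.HubbardSuperconductivity.Theses.IntrinsicLargeN.PairSectorShadow := by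
  intro h1 h2 δ hδ γ U₁ hγ hU₁ hKL
  obtain ⟨U₂, hU₂, hB1⟩ := h1 δ hδ γ U₁ hγ hU₁ hKL
  obtain ⟨U₃, hU₃, hB2⟩ := h2 δ hδ
  refine ⟨1, one_pos, min U₂ U₃, lt_min hU₂ hU₃, ?_⟩
  intro U hU
  have hU2 : U ∈ Set.Ioo (0:ℝ) U₂ := ⟨hU.1, lt_of_lt_of_le hU.2 (min_le_left _ _)⟩
  have hU3 : U ∈ Set.Ioo (0:ℝ) U₃ := ⟨hU.1, lt_of_lt_of_le hU.2 (min_le_right _ _)⟩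
  obtain ⟨a, ha, l₁, hl₁, hB1U⟩ := hB1 U hU2
  obtain ⟨l₂, hl₂, hB2U⟩ := hB2 U hU3 (a / 2) (half_pos ha)
  have hlpos : 0 < min l₁ l₂ := lt_min hl₁ hl₂
  obtain ⟨L₁, hL₁⟩ := hB1U (min l₁ l₂) ⟨hlpos, min_le_left _ _⟩
  obtain ⟨L₂, hL₂⟩ := hB2U (min l₁ l₂) ⟨hlpos, min_le_right _ _⟩
  have hCpos : (0:ℝ) <
      (∑ e ∈ insert 0 unitSteps, ‖((dWaveFormFactor e / Real.sqrt 2 : ℝ) : ℂ)‖ * 2) ^ 2 + 1 := by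
    positivity
  have hθ : 1 - a / 2 /
      ((∑ e ∈ insert 0 unitSteps, ‖((dWaveFormFactor e / Real.sqrt 2 : ℝ) : ℂ)‖ * 2) ^ 2 + 1) < 1 := by
    have := div_pos (half_pos ha) hCpos
    linarith
  refine ⟨U ^ 2, le_of_eq (one_mul _), 1 / 2,
    1 - a / 2 / ((∑ e ∈ insert 0 unitSteps, ‖((dWaveFormFactor e / Real.sqrt 2 : ℝ) : ℂ)‖ * 2) ^ 2 + 1),
    by norm_num, hθ, max L₁ L₂, ?_⟩
  intro L _ hL hEven D H S
  have hgain := hL₁ L (le_trans (le_max_left _ _) hL) hEven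
  obtain ⟨ψ₀, hψ₀, hGS, hresp⟩ := hL₂ L (le_trans (le_max_right _ _) hL) hEven
  have hLpos : (0:ℝ) < (L : ℝ) := Nat.cast_pos.mpr (Nat.pos_of_ne_zero (NeZero.ne L))
  have hLne : (L : ℝ) ≠ 0 := hLpos.ne'
  have hL2 : (0:ℝ) < (L : ℝ) ^ 2 := by positivity
  have hL4 : (0:ℝ) < (L : ℝ) ^ 4 := by positivity
  -- the squeeze: `(a/2)·L⁴ ≤ Re⟨ψ₀, Δ_d†Δ_d ψ₀⟩`
  have hX : a / 2 * (L : ℝ) ^ 4 ≤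
      (expect ((pairField dWaveFormFactor L)ᴴ * pairField dWaveFormFactor L) ψ₀).re := by
    have h1 : a / 2 * min l₁ l₂ * (L : ℝ) ^ 2 ≤ min l₁ l₂ / (L : ℝ) ^ 2 *
        (expect ((pairField dWaveFormFactor L)ᴴ * pairField dWaveFormFactor L) ψ₀).re := by
      linarith
    have hq : 0 < min l₁ l₂ / (L : ℝ) ^ 2 := div_pos hlpos hL2
    have h2 : min l₁ l₂ / (L : ℝ) ^ 2 * (a / 2 * (L : ℝ) ^ 4) ≤ min l₁ l₂ / (L : ℝ) ^ 2 *
        (expect ((pairField dWaveFormFactor L)ᴴ * pairField dWaveFormFactor L) ψ₀).re := by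
      have e : min l₁ l₂ / (L : ℝ) ^ 2 * (a / 2 * (L : ℝ) ^ 4) = a / 2 * min l₁ l₂ * (L : ℝ) ^ 2 := by
        rw [div_mul_eq_mul_div, div_eq_iff (pow_ne_zero 2 hLne)]
        ring
      rw [e]
      exact h1
    exact le_of_mul_le_mul_left h2 hq
  -- the shadow (collapse step): `κ := 1`, `g := U²`, `ε := 1/2`, `θ := 1 − (a/2)/(C_d² + 1)`
  obtain ⟨φ₀, hφ₀1, hφ₀GS⟩ :=
    exists_unit_groundStateInSector_hubbardTorus L 1 0 (floor_pairNumber_le δ (by linarith [hδ.1]) L)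
  obtain ⟨φ, hφS, hφ1, hφE, hφD⟩ := shadow_of_condensed (hubbardTorus 2 L 1 0)
    ((pairField dWaveFormFactor L)ᴴ * pairField dWaveFormFactor L)
    (szSector (Λ := FermionTorus 2 L) (2 * ⌊(1 - δ) * (L : ℝ) ^ 2 / 2⌋₊) 0)
    (U ^ 2 / (L : ℝ) ^ 2) (a / 2)
    ((∑ e ∈ insert 0 unitSteps, ‖((dWaveFormFactor e / Real.sqrt 2 : ℝ) : ℂ)‖ * 2) ^ 2 + 1)
    ((L : ℝ) ^ 4) (by positivity) (half_pos ha) hCpos hL4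
    (fun χ => re_rayleigh_pairSq_nonneg L χ) (fun χ hχ => re_rayleigh_pairSq_le L χ hχ)
    ⟨φ₀, hφ₀GS.1, hφ₀1, hφ₀GS.2.2⟩ ψ₀ hGS.1 hψ₀ hX
  exact ⟨ψ₀, hψ₀, hGS, φ, hφS, hφ1, hφE, hφD⟩

/-- **`PairSectorShadow_of_stubs`** — the same composition applied to the two DECLARED stubs (harness
skeleton convention A12: concludes the crux BY NAME with no hypotheses; its only `sorryAx` dependence is
through `stub_sourcedPairCondensation` and `stub_linearPairResponse`). [folklore] -/
theorem PairSectorShadow_of_stubs :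
    Summit.HubbardSuperconductivity.HubbardSuperconductivity.Theses.IntrinsicLargeN.PairSectorShadow :=
  PairSectorShadow_of stub_sourcedPairCondensation stub_linearPairResponse

end Summit.HubbardSuperconductivity.HubbardSuperconductivity.Cruxes.PairSectorShadow.Birth

end
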